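import Summits.QuantumAdvantage.QuantumAdvantage.Theorems.CubicForrelationSignedCubicForrelationNotPrBPPStubKernelNormalForm

/-!
# `NearExactIsExact` (stmt-QuantumAdvantage-14043) — the kernel dichotomy behind the RANK LEMMA (gen 41)

DISPROOF.md §47.27 (RANK LEMMA): in the `naff = 5` normal form of the b2b cell a two-sided frame with
`E ≠ 0` has mixing `A = α ⊗ τ` of rank `≤ 1`.  Its load-bearing step is the following piece of linear
algebra over `𝔽₂`: the row forms `aᵢ` of the mixing matrix are linear forms VANISHING ON THE ZERO SET of
the linear form `α` (because `aᵢ = α · (M̄ᵀτ′)ᵢ` as functions), and a linear form vanishing on `{α = 0}`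
is `0` or `α` — so every `aᵢ ∈ {0, α}` and `A = α ⊗ τ`.  We prove this dichotomy for ADDITIVE Boolean maps
(`rk1_additive_dichotomy`), transport it to the tree's `IsDegLeFun 1` functions vanishing at the origin
(`rk1_linear_dichotomy`, via `knf_additive_of_isDegLeFun_one`), and package the matrix consequence
(`rk1_rank_le_one`: a family of linear forms all vanishing on `{α = 0}` is `α ⊗ τ` for a Boolean vector `τ`).

HONEST FRAMING: a small kernel-checked lemma supporting the disproof programme's paper chain
(§47.27), NOT summit progress.
-/

set_option linter.dupNamespace false -- D-0017: single-problem summit ⇒ `QuantumAdvantage.QuantumAdvantage` by design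

namespace Summit.QuantumAdvantage.QuantumAdvantage.Theorems.NearExactIsExact.Negative.RankOneKernel

open Literature.Computability.QuantumComplexity
open Literature.Computability.QuantumComplexity.BuzetChailloux (bxor zeroVec)
open Summit.QuantumAdvantage.QuantumAdvantage.Theorems.SignedCubicForrelationNotPrBPP
  (knf_additive_of_isDegLeFun_one)

variable {N : ℕ}

/-- **Kernel dichotomy for additive maps `𝔽₂ᴺ → 𝔽₂`.** If `a` vanishes wherever `α` does, then `a = 0`
or `a = α` (the kernel of a nonzero additive map has index two). [folklore] -/
theorem rk1_additive_dichotomy {a α : (Fin N → Bool) → Bool}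
    (ha : ∀ x y, a (bxor x y) = (a x ^^ a y)) (hα : ∀ x y, α (bxor x y) = (α x ^^ α y))
    (h : ∀ x, α x = false → a x = false) :
    (a = fun _ => false) ∨ a = α := by
  by_cases hex : ∃ x₀, α x₀ = true ∧ a x₀ = true
  · right
    obtain ⟨x₀, h1, h2⟩ := hex
    funext x
    cases hx : α x with
    | false => exact h x hx
    | true =>
      have hk : α (bxor x x₀) = false := by rw [hα, hx, h1]; rfl
      have hz := h _ hk
      rw [ha, h2] at hz
      cases hax : a x with
      | true => rfl
      | false => rw [hax] at hz; exact absurd hz (by decide)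
  · left
    push Not at hex
    funext x
    cases hx : α x with
    | false => exact h x hx
    | true => simpa using hex x hx

/-- **Kernel dichotomy for linear Boolean functions** (degree `≤ 1`, vanishing at the origin): a linear
form vanishing on the zero set of the linear form `α` is `0` or `α`.  This is the step of the RANK LEMMA
(DISPROOF.md §47.27) forcing every row form of the mixing matrix into `{0, α}`. [folklore] -/
theorem rk1_linear_dichotomy {a α : (Fin N → Bool) → Bool}
    (ha : IsDegLeFun 1 a) (hα : IsDegLeFun 1 α) (ha0 : a zeroVec = false) (hα0 : α zeroVec = false)
    (h : ∀ x, α x = false → a x = false) :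
    (a = fun _ => false) ∨ a = α := by
  refine rk1_additive_dichotomy (fun x y => ?_) (fun x y => ?_) h
  · simpa [ha0] using knf_additive_of_isDegLeFun_one ha x y
  · simpa [hα0] using knf_additive_of_isDegLeFun_one hα x y

/-- **Rank `≤ 1`.** A family `a₀, …, a_{m-1}` of linear Boolean forms all vanishing on `{α = 0}` is the
rank-one family `α ⊗ τ`: `aᵢ(x) = τᵢ ∧ α(x)` for a Boolean vector `τ` — the conclusion `A = α ⊗ τ` of the
RANK LEMMA (DISPROOF.md §47.27) once its hypothesis "every `aᵢ` vanishes on `{α = 0}`" is granted.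
[folklore] -/
theorem rk1_rank_le_one {m : ℕ} {α : (Fin N → Bool) → Bool} (a : Fin m → (Fin N → Bool) → Bool)
    (ha : ∀ i, IsDegLeFun 1 (a i)) (hα : IsDegLeFun 1 α) (ha0 : ∀ i, a i zeroVec = false)
    (hα0 : α zeroVec = false) (h : ∀ i x, α x = false → a i x = false) :
    ∃ τ : Fin m → Bool, ∀ i x, a i x = (τ i && α x) := by
  classical
  refine ⟨fun i => decide (a i = α), fun i x => ?_⟩
  show a i x = (decide (a i = α) && α x)
  rcases rk1_linear_dichotomy (ha i) hα (ha0 i) hα0 (h i) with hz | he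
  · by_cases hne : a i = α
    · rw [decide_eq_true hne, Bool.true_and, hne]
    · rw [decide_eq_false hne, Bool.false_and, hz]
  · rw [decide_eq_true he, Bool.true_and, he]

end Summit.QuantumAdvantage.QuantumAdvantage.Theorems.NearExactIsExact.Negative.RankOneKernel
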